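import Mathlib
import Summits.Ventures.PercRepro2.V2SP
import Summits.Ventures.PercRepro2.Tail2DDisjointPaths
import Summits.Ventures.PercRepro2.Tail2DOffAxis31
import Summits.Ventures.PercRepro2.Tail2DP2SeriesSP
import Summits.Ventures.PercRepro2.Tail2DStepRowZero
import Summits.Ventures.PercRepro2.Tail2DStepCert

/-!
# The unit-STEP family (US) on series–parallel networks: definitions, its consequences QSTEP and STEP,
the offset-one identity, the series step, and the reduction of the whole family to its parallel step
(seat mine-b, cell pub-perc-repro2; MINE-B.md §39.3)

For a pattern `s` of the cell's grammar with red / blue flows `r, b` put `U(i,j) := Σ_{r = i ∧ b ≥ j} b`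
(`unitCount`): every configuration with `b` edge-disjoint blue paths carries `b` blue units, and `U(i,j)`
counts the blue units of the configurations with exactly `i` red paths and at least `j` blue paths.
Likewise `(i+1)·H(i+1,j−1)` counts the red units of the configurations with exactly `i+1` red paths and at
least `j−1` blue paths.  The unit-STEP inequality

  `(US)(i,j) : U(i,j) ≤ (i+1)·H(i+1,j−1)`   (`UnitStep s i j`, `j ≥ i+2`)

is the unit relay of the lane (one move per blue unit out of every source, at most one per red unit into
every target) as a counting statement.  It is tight on every bundle of free edges and census-true on every
series–parallel pattern with `≤ 11` atoms and on every two-terminal graph with `≤ 6` vertices (§39.3).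
Here: `(US) ⟹ QSTEP : j·H(i,j) ≤ (i+1)·H(i+1,j−1) ⟹ STEP : H(i,j) ≤ H(i+1,j−1)` (`qstep_of_unitStep`,
`step_of_qstep`); the offset-one member `(US)(i,i+1)` is equivalent to `(US)(i,i+2)` by the colour swap
(`unitStep_offset_one_iff`); the atoms satisfy (US); the SERIES step (`unitStep_ser`): the unit count of a
series composition is at most `U₁(i,j)·T₂(i,j) + T₁(i+1,j)·U₂(i,j)` (the blue flow of a series composition is
the minimum of the two, so its units are among the units of the tight factor), and with (US) of both factors
and the anti-diagonal comparisons `T₂(i,j) ≤ T₂(i+1,j−1)`, `T₁(i+1,j) ≤ T₁(i+2,j−1)` (which STEP gives by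
telescoping) this is `(i+1)·H''(i+1,j−1)` by `card_H_ser`.  Hence (`unitStep_all_of_par`): IF the parallel step
of (US) holds — (US) at every member on both factors ⟹ (US) at every member on the parallel composition —
THEN (US), QSTEP, STEP and the whole anti-diagonal unimodality `T(a,j) ≤ T(a−1,j+1)` hold on every pattern of
the grammar.  The parallel step is the open item of §39.3 (no product-form certificate over the lane's linear
dictionaries, kit j315171); nothing here is claimed beyond the reduction.
-/

namespace Summit.Ventures.PercRepro2.Tail2D

open V2Closure

section Defs

variable (s : V2Closure.SP)

/-- the unit-weighted count `U(i,j) = Σ_{r = i ∧ b ≥ j} b`: the blue units of the configurations with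
exactly `i` red paths and at least `j` blue paths -/
def unitCount (i j : ℕ) : ℕ := ∑ x, if s.rLab x = i ∧ j ≤ s.bLab x then s.bLab x else 0

/-- **the unit-STEP inequality** `(US)(i,j)`: `U(i,j) ≤ (i+1)·#{r = i+1 ∧ b ≥ j−1}` — the blue units of the
sources are fewer than the red units of the targets -/
def UnitStep (i j : ℕ) : Prop :=
  unitCount s i j ≤ (i + 1) * (Finset.univ.filter (fun y : s.Conf => s.rLab y = i + 1 ∧ j - 1 ≤ s.bLab y)).card

/-- `j·H(i,j) ≤ U(i,j)`: every source carries at least `j` blue units -/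
lemma unitCount_ge (i j : ℕ) :
    j * (Finset.univ.filter (fun y : s.Conf => s.rLab y = i ∧ j ≤ s.bLab y)).card ≤ unitCount s i j := by
  unfold unitCount
  rw [Finset.card_filter, Finset.mul_sum]
  refine Finset.sum_le_sum (fun y _ => ?_)
  split_ifs with h <;> omega

/-- (US) ⟹ QSTEP: `j·H(i,j) ≤ (i+1)·H(i+1,j−1)` (the binomial-ratio form of STEP, MINE-B.md §10.3c) -/
theorem qstep_of_unitStep (i j : ℕ) (h : UnitStep s i j) :
    j * (Finset.univ.filter (fun y : s.Conf => s.rLab y = i ∧ j ≤ s.bLab y)).card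
      ≤ (i + 1) * (Finset.univ.filter (fun y : s.Conf => s.rLab y = i + 1 ∧ j - 1 ≤ s.bLab y)).card :=
  le_trans (unitCount_ge s i j) h

/-- QSTEP ⟹ STEP whenever `j ≥ i+1` (cancel the factor `i+1 ≤ j`) -/
theorem step_of_qstep (i j : ℕ) (hij : i + 1 ≤ j)
    (h : j * (Finset.univ.filter (fun y : s.Conf => s.rLab y = i ∧ j ≤ s.bLab y)).card
      ≤ (i + 1) * (Finset.univ.filter (fun y : s.Conf => s.rLab y = i + 1 ∧ j - 1 ≤ s.bLab y)).card) :
    (Finset.univ.filter (fun y : s.Conf => s.rLab y = i ∧ j ≤ s.bLab y)).card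
      ≤ (Finset.univ.filter (fun y : s.Conf => s.rLab y = i + 1 ∧ j - 1 ≤ s.bLab y)).card := by
  have h1 : (i + 1) * (Finset.univ.filter (fun y : s.Conf => s.rLab y = i ∧ j ≤ s.bLab y)).card
      ≤ (i + 1) * (Finset.univ.filter (fun y : s.Conf => s.rLab y = i + 1 ∧ j - 1 ≤ s.bLab y)).card :=
    le_trans (Nat.mul_le_mul_right _ hij) h
  exact Nat.le_of_mul_le_mul_left h1 (by omega)

/-- (US) ⟹ STEP for `j ≥ i+1` -/
theorem step_of_unitStep (i j : ℕ) (hij : i + 1 ≤ j) (h : UnitStep s i j) :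
    (Finset.univ.filter (fun y : s.Conf => s.rLab y = i ∧ j ≤ s.bLab y)).card
      ≤ (Finset.univ.filter (fun y : s.Conf => s.rLab y = i + 1 ∧ j - 1 ≤ s.bLab y)).card :=
  step_of_qstep s i j hij (qstep_of_unitStep s i j h)

/-- `U(i,j) = U(i,j+1) + j·N(i,j)`: the units of the cell `(i,j)` -/
lemma unitCount_succ (i j : ℕ) :
    unitCount s i j = unitCount s i (j + 1)
      + j * (Finset.univ.filter (fun y : s.Conf => s.rLab y = i ∧ s.bLab y = j)).card := by
  unfold unitCount
  rw [Finset.card_filter, Finset.mul_sum, ← Finset.sum_add_distrib]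
  refine Finset.sum_congr rfl (fun y _ => ?_)
  split_ifs <;> omega

/-- `H(i+1,j−1) = H(i+1,j) + N(i+1,j−1)` -/
lemma H_split (i j : ℕ) :
    (Finset.univ.filter (fun y : s.Conf => s.rLab y = i + 1 ∧ j ≤ s.bLab y)).card
      = (Finset.univ.filter (fun y : s.Conf => s.rLab y = i + 1 ∧ j + 1 ≤ s.bLab y)).card
        + (Finset.univ.filter (fun y : s.Conf => s.rLab y = i + 1 ∧ s.bLab y = j)).card := by
  rw [Finset.card_filter, Finset.card_filter, Finset.card_filter, ← Finset.sum_add_distrib]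
  refine Finset.sum_congr rfl (fun y _ => ?_)
  split_ifs <;> omega

/-- the cell `(i, i+1)` has the count of the cell `(i+1, i)` (the colour swap) -/
lemma card_cell_swap (i : ℕ) :
    (Finset.univ.filter (fun y : s.Conf => s.rLab y = i ∧ s.bLab y = i + 1)).card
      = (Finset.univ.filter (fun y : s.Conf => s.rLab y = i + 1 ∧ s.bLab y = i)).card := by
  rw [← card_swap s (fun r b => r = i + 1 ∧ b = i)]
  congr 1; ext y; simp only [Finset.mem_filter, Finset.mem_univ, true_and]; exact and_comm

/-- **the offset-one identity**: `(US)(i,i+1) ⟺ (US)(i,i+2)` — both sides of the two members differ by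
`(i+1)·N(i,i+1) = (i+1)·N(i+1,i)` (the colour swap) -/
theorem unitStep_offset_one_iff (i : ℕ) : UnitStep s i (i + 1) ↔ UnitStep s i (i + 2) := by
  unfold UnitStep
  have e1 := unitCount_succ s i (i + 1)
  have e2 := H_split s i i
  have e3 := card_cell_swap s i
  have e4 : (Finset.univ.filter (fun y : s.Conf => s.rLab y = i + 1 ∧ i + 1 - 1 ≤ s.bLab y)).card
      = (Finset.univ.filter (fun y : s.Conf => s.rLab y = i + 1 ∧ i ≤ s.bLab y)).card := rfl
  have e5 : (Finset.univ.filter (fun y : s.Conf => s.rLab y = i + 1 ∧ i + 2 - 1 ≤ s.bLab y)).card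
      = (Finset.univ.filter (fun y : s.Conf => s.rLab y = i + 1 ∧ i + 1 ≤ s.bLab y)).card := rfl
  rw [e4, e5, e1, e2, e3]
  constructor <;> intro h <;> nlinarith

end Defs

section Atoms

/-- the atoms satisfy (US) at every member `j ≥ i+2`: their blue flow is `≤ 1`, so there are no sources -/
lemma unitStep_atom (s : V2Closure.SP) (hs : s = .free ∨ s = .pin ∨ s = .absent) (i j : ℕ) (hij : i + 2 ≤ j) :
    UnitStep s i j := by
  unfold UnitStep unitCount
  have h0 : ∑ x, (if s.rLab x = i ∧ j ≤ s.bLab x then s.bLab x else 0) = 0 :=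
    Finset.sum_eq_zero (fun x _ => by have := atom_bLab_le_one s hs x; split_ifs <;> omega)
  rw [h0]; exact Nat.zero_le _

end Atoms

section Series

variable (s t : V2Closure.SP)

/-- on a product of configuration spaces, the sum of a product of weights is the product of the sums -/
lemma sum_prod_mul (f : s.Conf → ℕ) (g : t.Conf → ℕ) :
    (∑ y : s.Conf × t.Conf, f y.1 * g y.2) = (∑ a : s.Conf, f a) * (∑ b : t.Conf, g b) := by
  rw [Finset.sum_mul_sum, ← Fintype.sum_prod_type']

/-- **the unit count of a series composition**: `U''(i,j) ≤ U₁(i,j)·T₂(i,j) + T₁(i+1,j)·U₂(i,j)` — the blue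
flow of a series composition is the minimum of the two flows, so every blue unit of the composition is a unit
of the tight factor (`min b₁ b₂ ≤ b₁`), the red level being attained by the first factor or, if the first is
strictly above it, by the second -/
lemma unitCount_ser_le (i j : ℕ) :
    unitCount (V2Closure.SP.ser s t) i j
      ≤ unitCount s i j * (Finset.univ.filter (fun y : t.Conf => i ≤ t.rLab y ∧ j ≤ t.bLab y)).card
        + (Finset.univ.filter (fun y : s.Conf => i + 1 ≤ s.rLab y ∧ j ≤ s.bLab y)).card * unitCount t i j := by
  unfold unitCount
  simp only [Finset.card_filter]
  rw [← sum_prod_mul s t (fun a => if s.rLab a = i ∧ j ≤ s.bLab a then s.bLab a else 0)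
        (fun c => if i ≤ t.rLab c ∧ j ≤ t.bLab c then 1 else 0),
    ← sum_prod_mul s t (fun a => if i + 1 ≤ s.rLab a ∧ j ≤ s.bLab a then 1 else 0)
        (fun c => if t.rLab c = i ∧ j ≤ t.bLab c then t.bLab c else 0),
    ← Finset.sum_add_distrib]
  refine Finset.sum_le_sum (fun y _ => ?_)
  simp only [SP.rLab, SP.bLab, serR, serB]
  split_ifs <;> omega

/-- **the series step of (US)**: (US) of both factors and the anti-diagonal comparisons
`T₂(i,j) ≤ T₂(i+1,j−1)`, `T₁(i+1,j) ≤ T₁(i+2,j−1)` give (US) of the series composition -/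
theorem unitStep_ser (i j : ℕ) (hs : UnitStep s i j) (ht : UnitStep t i j)
    (hTt : (Finset.univ.filter (fun y : t.Conf => i ≤ t.rLab y ∧ j ≤ t.bLab y)).card
      ≤ (Finset.univ.filter (fun y : t.Conf => i + 1 ≤ t.rLab y ∧ j - 1 ≤ t.bLab y)).card)
    (hTs : (Finset.univ.filter (fun y : s.Conf => i + 1 ≤ s.rLab y ∧ j ≤ s.bLab y)).card
      ≤ (Finset.univ.filter (fun y : s.Conf => i + 1 + 1 ≤ s.rLab y ∧ j - 1 ≤ s.bLab y)).card) :
    UnitStep (V2Closure.SP.ser s t) i j := by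
  unfold UnitStep at hs ht ⊢
  rw [card_H_ser]
  calc unitCount (V2Closure.SP.ser s t) i j
      ≤ unitCount s i j * (Finset.univ.filter (fun y : t.Conf => i ≤ t.rLab y ∧ j ≤ t.bLab y)).card
        + (Finset.univ.filter (fun y : s.Conf => i + 1 ≤ s.rLab y ∧ j ≤ s.bLab y)).card * unitCount t i j :=
        unitCount_ser_le s t i j
    _ ≤ ((i + 1) * (Finset.univ.filter (fun y : s.Conf => s.rLab y = i + 1 ∧ j - 1 ≤ s.bLab y)).card)
          * (Finset.univ.filter (fun y : t.Conf => i + 1 ≤ t.rLab y ∧ j - 1 ≤ t.bLab y)).card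
        + (Finset.univ.filter (fun y : s.Conf => i + 1 + 1 ≤ s.rLab y ∧ j - 1 ≤ s.bLab y)).card
          * ((i + 1) * (Finset.univ.filter (fun y : t.Conf => t.rLab y = i + 1 ∧ j - 1 ≤ t.bLab y)).card) :=
        Nat.add_le_add (Nat.mul_le_mul hs hTt) (Nat.mul_le_mul hTs ht)
    _ = (i + 1) * ((Finset.univ.filter (fun y : s.Conf => s.rLab y = i + 1 ∧ j - 1 ≤ s.bLab y)).card
          * (Finset.univ.filter (fun y : t.Conf => i + 1 ≤ t.rLab y ∧ j - 1 ≤ t.bLab y)).card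
        + (Finset.univ.filter (fun y : s.Conf => i + 1 + 1 ≤ s.rLab y ∧ j - 1 ≤ s.bLab y)).card
          * (Finset.univ.filter (fun y : t.Conf => t.rLab y = i + 1 ∧ j - 1 ≤ t.bLab y)).card) := by ring

end Series

section Reduction

/-- the anti-diagonal comparison `T(i,j) ≤ T(i+1,j−1)` for `j ≥ i+1` from (US) at every member (STEP by
`step_of_unitStep`, the telescoping `tail_le_of_steps`; the boundary `j = i+1` is the colour swap) -/
lemma tail_le_of_unitSteps (s : V2Closure.SP) (hus : ∀ i j, i + 2 ≤ j → UnitStep s i j) (i j : ℕ)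
    (hij : i + 1 ≤ j) :
    (Finset.univ.filter (fun y : s.Conf => i ≤ s.rLab y ∧ j ≤ s.bLab y)).card
      ≤ (Finset.univ.filter (fun y : s.Conf => i + 1 ≤ s.rLab y ∧ j - 1 ≤ s.bLab y)).card := by
  rcases (by omega : j = i + 1 ∨ i + 2 ≤ j) with h1 | h2
  · subst h1
    have e : (Finset.univ.filter (fun y : s.Conf => i + 1 ≤ s.rLab y ∧ i + 1 - 1 ≤ s.bLab y)).card
        = (Finset.univ.filter (fun y : s.Conf => i + 1 ≤ s.rLab y ∧ i ≤ s.bLab y)).card := rfl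
    rw [e]
    exact (tail_symm s i (i + 1)).le
  · exact tail_le_of_steps s j (j - 2 - i) i (by omega)
      (fun k hk hkj => step_of_unitStep s k j (by omega) (hus k j hkj))

/-- **the reduction of the unit-STEP family to its parallel step**: if (US) at every member on both factors
implies (US) at every member on their parallel composition, then (US) holds at every member `j ≥ i+2` on
every pattern of the grammar (induction over the grammar: atoms, the series step with the anti-diagonal
comparisons from the induction hypothesis, the assumed parallel step) -/
theorem unitStep_all_of_par
    (hpar : ∀ s t : V2Closure.SP, (∀ i j, i + 2 ≤ j → UnitStep s i j) → (∀ i j, i + 2 ≤ j → UnitStep t i j) →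
      ∀ i j, i + 2 ≤ j → UnitStep (V2Closure.SP.par s t) i j) :
    ∀ (s : V2Closure.SP) (i j : ℕ), i + 2 ≤ j → UnitStep s i j
  | .free, i, j, hij => unitStep_atom .free (Or.inl rfl) i j hij
  | .pin, i, j, hij => unitStep_atom .pin (Or.inr (Or.inl rfl)) i j hij
  | .absent, i, j, hij => unitStep_atom .absent (Or.inr (Or.inr rfl)) i j hij
  | .ser s t, i, j, hij =>
    unitStep_ser s t i j (unitStep_all_of_par hpar s i j hij) (unitStep_all_of_par hpar t i j hij)
      (tail_le_of_unitSteps t (fun i' j' h => unitStep_all_of_par hpar t i' j' h) i j (by omega))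
      (tail_le_of_unitSteps s (fun i' j' h => unitStep_all_of_par hpar s i' j' h) (i + 1) j (by omega))
  | .par s t, i, j, hij =>
    hpar s t (fun i' j' h => unitStep_all_of_par hpar s i' j' h)
      (fun i' j' h => unitStep_all_of_par hpar t i' j' h) i j hij

/-- under the parallel step of (US): QSTEP at every member on every pattern -/
theorem qstep_all_of_par
    (hpar : ∀ s t : V2Closure.SP, (∀ i j, i + 2 ≤ j → UnitStep s i j) → (∀ i j, i + 2 ≤ j → UnitStep t i j) →
      ∀ i j, i + 2 ≤ j → UnitStep (V2Closure.SP.par s t) i j)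
    (s : V2Closure.SP) (i j : ℕ) (hij : i + 2 ≤ j) :
    j * (Finset.univ.filter (fun y : s.Conf => s.rLab y = i ∧ j ≤ s.bLab y)).card
      ≤ (i + 1) * (Finset.univ.filter (fun y : s.Conf => s.rLab y = i + 1 ∧ j - 1 ≤ s.bLab y)).card :=
  qstep_of_unitStep s i j (unitStep_all_of_par hpar s i j hij)

/-- under the parallel step of (US): STEP at every member on every pattern -/
theorem step_all_of_par
    (hpar : ∀ s t : V2Closure.SP, (∀ i j, i + 2 ≤ j → UnitStep s i j) → (∀ i j, i + 2 ≤ j → UnitStep t i j) →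
      ∀ i j, i + 2 ≤ j → UnitStep (V2Closure.SP.par s t) i j)
    (s : V2Closure.SP) (i j : ℕ) (hij : i + 2 ≤ j) :
    (Finset.univ.filter (fun y : s.Conf => s.rLab y = i ∧ j ≤ s.bLab y)).card
      ≤ (Finset.univ.filter (fun y : s.Conf => s.rLab y = i + 1 ∧ j - 1 ≤ s.bLab y)).card :=
  step_of_unitStep s i j (by omega) (unitStep_all_of_par hpar s i j hij)

/-- under the parallel step of (US): the whole anti-diagonal unimodality `T(a,j) ≤ T(a−1,j+1)`, `j ≤ a−2`,
on every pattern (STEP telescoped, then the colour swap) -/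
theorem offaxis_all_of_par
    (hpar : ∀ s t : V2Closure.SP, (∀ i j, i + 2 ≤ j → UnitStep s i j) → (∀ i j, i + 2 ≤ j → UnitStep t i j) →
      ∀ i j, i + 2 ≤ j → UnitStep (V2Closure.SP.par s t) i j)
    (s : V2Closure.SP) (a j : ℕ) (hja : j + 2 ≤ a) :
    (Finset.univ.filter (fun y : s.Conf => a ≤ s.rLab y ∧ j ≤ s.bLab y)).card
      ≤ (Finset.univ.filter (fun y : s.Conf => a - 1 ≤ s.rLab y ∧ j + 1 ≤ s.bLab y)).card := by
  have h := tail_le_of_unitSteps s (fun i' j' h => unitStep_all_of_par hpar s i' j' h) j a (by omega)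
  rw [tail_symm s a j, tail_symm s (a - 1) (j + 1)]
  exact h

end Reduction

end Summit.Ventures.PercRepro2.Tail2D
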